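/-
Copyright (c) 2026 the pub-hodgecm-mathlib formalisation cell (harness21).  Prover seat hodgecm-mathlib-K2Liu-p01 (g0): Track B «K2-LIT», #184♮ = hLiu418,
helper H4a for socket #13 `sig_K2LiuDoublingUnfold` (U5 «DOUBLING ZETA», LEAD F0P6-plan (g10) DEAL 2026-09-03T21:14:18Z).
-/
import Mathlib.LinearAlgebra.Matrix.NonsingularInverse
import Mathlib.Data.Matrix.Block
import HarnessLib

/-!
# Crux `HLiu418`, Track B road `K2_Liu`, unit U5, helper H4a for socket #13: the SINGLE-ORBIT LEMMA in block-matrix form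
# (Liu 2021 (B.5) at `a = 0`, anisotropic `V`: `P_Δ \ U(V ⊕ −V) / ι(U(V) × 1)` is ONE point)

Cell `hodgecm-mathlib`, crux item hLiu418 = `stmt-HodgeConjecture-24832`; prover K2Liu-p01 (g0) (REPORT-FIRST plan for #13, item H4).  THEOREMS ONLY,
Mathlib-only imports (pure linear algebra), lane `--supports stmt-HodgeConjecture-24832 --as helper`.

SETTING.  A field `L` with a ring endomorphism `c` (complex conjugation of a CM field), an index type `ι`, a Gram matrix `J ∈ M_ι(L)` whose
`c`-sesquilinear form `⟪u, v⟫ = (c ∘ u) ⬝ᵥ (J v)` is ANISOTROPIC, the doubled Gram matrix `J^𝔻 = diag(J, −J)` on `ι ⊕ ι`, the diagonal `Δ = {(x, x)}`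
(totally isotropic), and a block matrix `B ∈ M_{ι ⊕ ι}(L)` preserving `J^𝔻`: `ᵗ(c B) J^𝔻 B = J^𝔻` (an element of `U(V ⊕ −V)(L)`).
WHAT IS PROVED (`exists_mainOrbit_block`).  There is `A ∈ M_ι(L)`, INVERTIBLE and `J`-UNITARY (`ᵗ(c A) J A = J`), with
`B₁₁ − B₂₁ = (B₂₂ − B₁₂) A`; consequently (`siegel_of_mainOrbit_block`) `P := B · diag(A⁻¹, 1)` satisfies the Siegel condition
`P₁₁ + P₁₂ = P₂₁ + P₂₂` (`P` stabilises `Δ`), i.e. `B ∈ P_Δ · ι(A, 1)`.  PROOF (the geometric content of ★ #12₀ `DoublingLagrangianIsGraph`, done in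
coordinates): `M := B₂₂ − B₁₂` is injective — `M v = 0` puts `B(0, v)` on `Δ`, so `−⟪v,v⟫ = ⟪B(0,v), B(0,v)⟫_𝔻 = 0`, `v = 0` by anisotropy — hence
invertible; `A := M⁻¹(B₁₁ − B₂₁)` makes `B(y, A y) ∈ Δ` for all `y`; `Δ` totally isotropic and `B` an isometry give `⟪y, y′⟫ = ⟪A y, A y′⟫`, i.e. `A` is
`J`-unitary, and `A y = 0 ⟹ B(y, 0) ∈ Δ ⟹ ⟪y, y⟫ = 0 ⟹ y = 0`.
HONEST LABEL.  Count-neutral helper; `HC_CM` is proved only modulo the 7 printed citations (hLiu418 = 24832, h413 = 24833) until rung 0 closes.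

## References
* [Liu2021] Y. Liu, *Fourier–Jacobi cycles and arithmetic relative trace formula*, Camb. J. Math. 9 (2021): App. B §B.3 (B.5) p. 101, Lem. B.11 p. 102.
* [GelbartPiatetskishapiroRallis1987] S. Gelbart, I. Piatetski-Shapiro, S. Rallis, LNM 1254 (1987), Part A §1 (the main orbit of the doubling method).
-/

namespace Summit.HodgeConjecture.HodgeConjecture.Cruxes.HLiu418.K2LiuDoublingUnfoldMainOrbitBlocks

open Matrix

variable {L : Type*} [Field L] (c : L →+* L) {ι : Type*} [Fintype ι]

/-! ## §1 Sesquilinear bookkeeping -/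

/-- `⟪B w, B w′⟫_H = ⟪w, (ᵗ(c B) H B) w′⟫`: the `c`-sesquilinear form of `H` after the substitution `w ↦ B w`. [folklore] -/
theorem conj_mulVec_dotProduct_mulVec {m : Type*} [Fintype m] [DecidableEq m] (B H : Matrix m m L) (w w' : m → L) :
    (⇑c ∘ (B *ᵥ w)) ⬝ᵥ (H *ᵥ (B *ᵥ w')) = (⇑c ∘ w) ⬝ᵥ (((B.map c)ᵀ * H * B) *ᵥ w') := by
  have h1 : (⇑c ∘ (B *ᵥ w)) = B.map c *ᵥ (⇑c ∘ w) := by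
    funext i
    exact RingHom.map_mulVec c B w i
  rw [h1]
  symm
  rw [Matrix.mul_assoc, ← mulVec_mulVec, ← mulVec_mulVec, dotProduct_mulVec, vecMul_transpose]

/-- An ISOMETRY `B` of `H` (`ᵗ(c B) H B = H`) preserves the form: `⟪B w, B w′⟫_H = ⟪w, w′⟫_H`. [folklore] -/
theorem conj_mulVec_dotProduct_mulVec_of_isometry {m : Type*} [Fintype m] [DecidableEq m] {B H : Matrix m m L}
    (hB : (B.map c)ᵀ * H * B = H) (w w' : m → L) :
    (⇑c ∘ (B *ᵥ w)) ⬝ᵥ (H *ᵥ (B *ᵥ w')) = (⇑c ∘ w) ⬝ᵥ (H *ᵥ w') := by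
  rw [conj_mulVec_dotProduct_mulVec, hB]

/-- The doubled form on pairs: `⟪(u₁,u₂), (v₁,v₂)⟫_{J ⊕ −J} = ⟪u₁, v₁⟫_J − ⟪u₂, v₂⟫_J`. [cite: Liu2021, §B.3 p. 101] -/
theorem doubled_form_sumElim (J : Matrix ι ι L) (u₁ u₂ v₁ v₂ : ι → L) :
    (⇑c ∘ Sum.elim u₁ u₂) ⬝ᵥ (Matrix.fromBlocks J 0 0 (-J) *ᵥ Sum.elim v₁ v₂) =
      (⇑c ∘ u₁) ⬝ᵥ (J *ᵥ v₁) - (⇑c ∘ u₂) ⬝ᵥ (J *ᵥ v₂) := by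
  have hc : (⇑c ∘ Sum.elim u₁ u₂) = Sum.elim (⇑c ∘ u₁) (⇑c ∘ u₂) := by
    funext i; cases i <;> rfl
  rw [hc, fromBlocks_mulVec, Sum.elim_comp_inl, Sum.elim_comp_inr, sumElim_dotProduct_sumElim, zero_mulVec, zero_mulVec, add_zero, zero_add,
    neg_mulVec, dotProduct_neg, sub_eq_add_neg]

/-- **The diagonal `Δ` is totally isotropic for `J ⊕ −J`**: `⟪(x,x), (y,y)⟫_{J ⊕ −J} = 0`. [cite: Liu2021, §B.3 p. 101] -/
theorem doubled_form_diag (J : Matrix ι ι L) (x y : ι → L) :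
    (⇑c ∘ Sum.elim x x) ⬝ᵥ (Matrix.fromBlocks J 0 0 (-J) *ᵥ Sum.elim y y) = 0 := by
  rw [doubled_form_sumElim, sub_self]

/-- `B (u₁, u₂) = (B₁₁ u₁ + B₁₂ u₂, B₂₁ u₁ + B₂₂ u₂)`. [folklore] -/
theorem mulVec_sumElim (B : Matrix (ι ⊕ ι) (ι ⊕ ι) L) (u₁ u₂ : ι → L) :
    B *ᵥ Sum.elim u₁ u₂ = Sum.elim (B.toBlocks₁₁ *ᵥ u₁ + B.toBlocks₁₂ *ᵥ u₂) (B.toBlocks₂₁ *ᵥ u₁ + B.toBlocks₂₂ *ᵥ u₂) := by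
  conv_lhs => rw [← fromBlocks_toBlocks B]
  rw [fromBlocks_mulVec, Sum.elim_comp_inl, Sum.elim_comp_inr]

/-! ## §2 The main-orbit block lemma -/

section Main

variable [DecidableEq ι]

/-- A sesquilinear identity on all vectors gives the matrix identity: if `⟪A y, A y′⟫_J = ⟪y, (K) y′⟫` for all `y, y′` then … — in the form used
here: **`(∀ y y′, ⟪A y, A y′⟫_J = ⟪y, y′⟫_J) ⟹ ᵗ(c A) J A = J`** (test on `Pi.single`; `c 1 = 1`, `c 0 = 0`). [folklore] -/
theorem conjTranspose_mul_mul_eq_of_forall (J A : Matrix ι ι L)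
    (h : ∀ y y' : ι → L, (⇑c ∘ (A *ᵥ y)) ⬝ᵥ (J *ᵥ (A *ᵥ y')) = (⇑c ∘ y) ⬝ᵥ (J *ᵥ y')) :
    (A.map c)ᵀ * J * A = J := by
  ext i j
  have hij := h (Pi.single i 1) (Pi.single j 1)
  rw [conj_mulVec_dotProduct_mulVec] at hij
  have hci : (⇑c ∘ (Pi.single i (1 : L) : ι → L)) = Pi.single i 1 := by
    funext k
    by_cases hk : k = i
    · subst hk; simp
    · simp [hk]
  rw [hci, mulVec_single_one, mulVec_single_one, single_one_dotProduct, single_one_dotProduct] at hij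
  exact hij

/-- **THE MAIN-ORBIT BLOCK LEMMA** (Liu 2021 (B.5) at `a = 0` for ANISOTROPIC `V`).  Let `J` be `c`-anisotropic and `B` an isometry of
`J ⊕ −J` on `ι ⊕ ι`.  Then there is an INVERTIBLE, `J`-UNITARY `A` with `B₁₁ − B₂₁ = (B₂₂ − B₁₂) · A` — i.e. `B` carries the graph
`{(y, A y)}` onto the diagonal `Δ`, so `B ∈ P_Δ · ι(A, 1)`. [cite: Liu2021, §B.3 (B.5) p. 101] [cite: GelbartPiatetskishapiroRallis1987, Part A §1] -/
theorem exists_mainOrbit_block (J : Matrix ι ι L) (hanis : ∀ v : ι → L, (⇑c ∘ v) ⬝ᵥ (J *ᵥ v) = 0 → v = 0)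
    (B : Matrix (ι ⊕ ι) (ι ⊕ ι) L) (hB : (B.map c)ᵀ * Matrix.fromBlocks J 0 0 (-J) * B = Matrix.fromBlocks J 0 0 (-J)) :
    ∃ A : Matrix ι ι L, IsUnit A ∧ (A.map c)ᵀ * J * A = J ∧ B.toBlocks₁₁ - B.toBlocks₂₁ = (B.toBlocks₂₂ - B.toBlocks₁₂) * A := by
  -- `B (u₁, u₂) ∈ Δ` forces `⟪u₁,u₁⟫ = ⟪u₂,u₂⟫`
  have key : ∀ u₁ u₂ : ι → L, B.toBlocks₁₁ *ᵥ u₁ + B.toBlocks₁₂ *ᵥ u₂ = B.toBlocks₂₁ *ᵥ u₁ + B.toBlocks₂₂ *ᵥ u₂ →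
      ∀ v₁ v₂ : ι → L, B.toBlocks₁₁ *ᵥ v₁ + B.toBlocks₁₂ *ᵥ v₂ = B.toBlocks₂₁ *ᵥ v₁ + B.toBlocks₂₂ *ᵥ v₂ →
      (⇑c ∘ u₁) ⬝ᵥ (J *ᵥ v₁) - (⇑c ∘ u₂) ⬝ᵥ (J *ᵥ v₂) = 0 := by
    intro u₁ u₂ hu v₁ v₂ hv
    have h1 := conj_mulVec_dotProduct_mulVec_of_isometry c hB (Sum.elim u₁ u₂) (Sum.elim v₁ v₂)
    rw [mulVec_sumElim, mulVec_sumElim, hu, hv, doubled_form_diag, doubled_form_sumElim] at h1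
    exact h1.symm
  -- `M := B₂₂ − B₁₂` is injective, hence invertible
  set M : Matrix ι ι L := B.toBlocks₂₂ - B.toBlocks₁₂ with hM
  have hMinj : Function.Injective M.mulVec := by
    intro v v' hvv'
    rw [← sub_eq_zero] at hvv' ⊢
    rw [← mulVec_sub] at hvv'
    set w := v - v' with hw
    have hΔ : B.toBlocks₁₁ *ᵥ (0 : ι → L) + B.toBlocks₁₂ *ᵥ w = B.toBlocks₂₁ *ᵥ 0 + B.toBlocks₂₂ *ᵥ w := by
      rw [mulVec_zero, mulVec_zero, zero_add, zero_add, ← sub_eq_zero, ← sub_mulVec, ← neg_sub, neg_mulVec, hvv', neg_zero]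
    have h0 := key 0 w hΔ 0 w hΔ
    have hc0 : (⇑c ∘ (0 : ι → L)) = 0 := by funext k; simp
    rw [hc0, zero_dotProduct, zero_sub, neg_eq_zero] at h0
    exact hanis w h0
  have hMunit : IsUnit M := mulVec_injective_iff_isUnit.1 hMinj
  have hMdet : IsUnit M.det := (isUnit_iff_isUnit_det M).1 hMunit
  -- `A := M⁻¹ (B₁₁ − B₂₁)`
  refine ⟨M⁻¹ * (B.toBlocks₁₁ - B.toBlocks₂₁), ?_, ?_, ?_⟩
  rotate_left
  · -- `J`-unitary
    have hgraph : ∀ y : ι → L, B.toBlocks₁₁ *ᵥ y + B.toBlocks₁₂ *ᵥ ((M⁻¹ * (B.toBlocks₁₁ - B.toBlocks₂₁)) *ᵥ y) =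
        B.toBlocks₂₁ *ᵥ y + B.toBlocks₂₂ *ᵥ ((M⁻¹ * (B.toBlocks₁₁ - B.toBlocks₂₁)) *ᵥ y) := by
      intro y
      rw [← sub_eq_zero]
      have h2 : B.toBlocks₁₁ *ᵥ y + B.toBlocks₁₂ *ᵥ ((M⁻¹ * (B.toBlocks₁₁ - B.toBlocks₂₁)) *ᵥ y) -
          (B.toBlocks₂₁ *ᵥ y + B.toBlocks₂₂ *ᵥ ((M⁻¹ * (B.toBlocks₁₁ - B.toBlocks₂₁)) *ᵥ y)) =
          (B.toBlocks₁₁ - B.toBlocks₂₁) *ᵥ y - M *ᵥ ((M⁻¹ * (B.toBlocks₁₁ - B.toBlocks₂₁)) *ᵥ y) := by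
        rw [hM, sub_mulVec, sub_mulVec]
        abel
      rw [h2, mulVec_mulVec, ← Matrix.mul_assoc, mul_nonsing_inv _ hMdet, Matrix.one_mul, sub_self]
    exact conjTranspose_mul_mul_eq_of_forall c J _ fun y y' => by
      have h3 := key y _ (hgraph y) y' _ (hgraph y')
      rw [sub_eq_zero] at h3
      exact h3.symm
  · -- the defining identity
    rw [← Matrix.mul_assoc, mul_nonsing_inv _ hMdet, Matrix.one_mul]
  · -- invertible: `A y = 0 ⟹ B(y, 0) ∈ Δ ⟹ ⟪y,y⟫ = 0`
    refine mulVec_injective_iff_isUnit.1 fun y y' hyy' => ?_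
    rw [← sub_eq_zero] at hyy' ⊢
    rw [← mulVec_sub] at hyy'
    set w := y - y' with hw
    have h4 : (B.toBlocks₁₁ - B.toBlocks₂₁) *ᵥ w = 0 := by
      have h5 : M *ᵥ ((M⁻¹ * (B.toBlocks₁₁ - B.toBlocks₂₁)) *ᵥ w) = 0 := by rw [hyy', mulVec_zero]
      rwa [mulVec_mulVec, ← Matrix.mul_assoc, mul_nonsing_inv _ hMdet, Matrix.one_mul] at h5
    have hΔ : B.toBlocks₁₁ *ᵥ w + B.toBlocks₁₂ *ᵥ (0 : ι → L) = B.toBlocks₂₁ *ᵥ w + B.toBlocks₂₂ *ᵥ 0 := by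
      rw [mulVec_zero, mulVec_zero, add_zero, add_zero, ← sub_eq_zero, ← sub_mulVec, h4]
    have h0 := key w 0 hΔ w 0 hΔ
    have hc0 : (⇑c ∘ (0 : ι → L)) = 0 := by funext k; simp
    rw [hc0, zero_dotProduct, sub_zero] at h0
    exact hanis w h0

/-- **The Siegel condition for `P := B · diag(A⁻¹, 1)`**: with `A` as in `exists_mainOrbit_block` (invertible, `B₁₁ − B₂₁ = (B₂₂ − B₁₂) A`),
`P₁₁ + P₁₂ = P₂₁ + P₂₂` — `P` stabilises the diagonal `Δ`, i.e. `B = P · ι(A, 1)` with `P ∈ P_Δ`. [cite: Liu2021, Lem. B.11 p. 102] -/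
theorem siegel_of_mainOrbit_block (B : Matrix (ι ⊕ ι) (ι ⊕ ι) L) {A : Matrix ι ι L} (hA : IsUnit A)
    (hBA : B.toBlocks₁₁ - B.toBlocks₂₁ = (B.toBlocks₂₂ - B.toBlocks₁₂) * A) :
    (B * Matrix.fromBlocks A⁻¹ 0 0 1).toBlocks₁₁ + (B * Matrix.fromBlocks A⁻¹ 0 0 1).toBlocks₁₂ =
      (B * Matrix.fromBlocks A⁻¹ 0 0 1).toBlocks₂₁ + (B * Matrix.fromBlocks A⁻¹ 0 0 1).toBlocks₂₂ := by
  have hAdet : IsUnit A.det := (isUnit_iff_isUnit_det A).1 hA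
  conv_lhs => rw [← fromBlocks_toBlocks B]
  conv_rhs => rw [← fromBlocks_toBlocks B]
  rw [fromBlocks_multiply]
  simp only [toBlocks_fromBlocks₁₁, toBlocks_fromBlocks₁₂, toBlocks_fromBlocks₂₁, toBlocks_fromBlocks₂₂, Matrix.mul_zero,
    add_zero, zero_add, Matrix.mul_one]
  rw [← sub_eq_zero]
  have h : B.toBlocks₁₁ * A⁻¹ + B.toBlocks₁₂ - (B.toBlocks₂₁ * A⁻¹ + B.toBlocks₂₂) =
      (B.toBlocks₁₁ - B.toBlocks₂₁) * A⁻¹ - (B.toBlocks₂₂ - B.toBlocks₁₂) := by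
    rw [sub_mul]; abel
  rw [h, hBA, Matrix.mul_assoc, mul_nonsing_inv _ hAdet, Matrix.mul_one, sub_self]

end Main

end Summit.HodgeConjecture.HodgeConjecture.Cruxes.HLiu418.K2LiuDoublingUnfoldMainOrbitBlocks
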